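import Summits.AnomalousDissipation.AnomalousDissipation.Theorems.SawtoothPulseCascadeK1LocalisedCascadeSlotFibreUngauge

/-!
# K1loc, line `Spectral` / SeqCone — helper: UN-GAUGING THE TWO FLAT-STRIP FAMILIES FOR EVERY SMOOTH FUNCTION (T1, brick 4)

Helper file of the prover lane on the crux `K1LocalisedCascade` (stmt-AnomalousDissipation-19491), route
`SawtoothPulseCascade` (memo v4 §3, target T1).  `…SlotFibreSum` proves the two-strip un-gauging estimate for band-limited
`θ`; here the band limitation is removed by truncation, exactly as in g0's `…KoopmanLeakageFull`: both the shear and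
the multiplication by a function of `x_j` act fibrewise (`mFourierCoeff_evalMul_eq_zero_of_apply_not_mem`), so every
finite partial sum of the left side is a partial sum for a band-limited truncation `θ_N`, for which the estimate holds
with right side monotone in `N`.  Results: `tsum_symbol_sq_twoStrip_le_of_fibre` (abstract per-fibre estimate), its `√`-form
`sqrt_tsum_symbol_sq_twoStrip_le_of_fibre` under the compatibility of symbols, and `tsum_symbol_sq_twoStrip_le` (the
per-fibre estimate discharged by un-gauging + the two-branch step).  No definitions; no statement about the stub.
[cite: Grafakos2014, Prop. 3.1.2 (5) (coefficients of products, translations and modulations) and Prop. 3.2.7 (3)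
(Parseval)] [problem: turb]
-/

-- `Summit.<Summit>.<Problem>`: single-conjunct summit, the duplicate namespace segment is deliberate.
set_option linter.dupNamespace false

noncomputable section

namespace Summit.AnomalousDissipation.AnomalousDissipation.Theorems.SawtoothPulseCascade.K1Slot

open MeasureTheory Set Filter Topology UnitAddTorus Function
open scoped ComplexConjugate
open Literature.Analysis Literature.Analysis.FunctionSpaces Literature.Analysis.FunctionSpaces.Torus
open Literature.Analysis.FluidPDE.ScalarFourier (lconv lconv_apply)
open Summit.AnomalousDissipation.AnomalousDissipation.Theorems.SawtoothPulseCascade.SpectralLeakage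

variable {d : Type*} [Fintype d] [DecidableEq d]

/-! ## Fibre locality of the multiplication by a function of `x_j` -/

/-- **Multiplication by a function of `x_j` preserves the support in the `i`-th frequency** (`i ≠ j`): if `𝓕θ` vanishes
off `{k : k_i ∈ A}`, so does `𝓕(G(x_j)·θ)` (the coefficients of `x ↦ G(x_j)` live on the `e_j`-axis, and the coefficients
of a product are a lattice convolution). [cite: Grafakos2014, Prop. 3.1.2 (5)] -/
theorem mFourierCoeff_evalMul_eq_zero_of_apply_not_mem {G : UnitAddCircle → ℂ} (hG : Continuous G) {i j : d}
    (hij : i ≠ j) (hGs : Summable fun q => ‖mFourierCoeff (fun x : UnitAddTorus d => G (x j)) q‖)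
    {θ : UnitAddTorus d → ℂ} (hθ : Continuous θ) {A : Set ℤ} (hA : ∀ k : d → ℤ, k i ∉ A → mFourierCoeff θ k = 0)
    {k : d → ℤ} (hk : k i ∉ A) : mFourierCoeff (fun x => G (x j) * θ x) k = 0 := by
  have hGc : Continuous fun x : UnitAddTorus d => G (x j) := hG.comp (continuous_apply j)
  rw [Literature.Analysis.FluidPDE.ScalarFourier.mFourierCoeff_mul hGc hGs hθ k, lconv_apply]
  refine (tsum_congr fun q => ?_).trans tsum_zero
  by_cases hq : ∀ l, l ≠ j → q l = 0
  · have hki : (k - q) i ∉ A := by rwa [Pi.sub_apply, hq i hij, sub_zero]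
    rw [hA _ hki, mul_zero]
  · push Not at hq
    obtain ⟨l, hl, hql⟩ := hq
    rw [mFourierCoeff_comp_eval_eq_zero G j hl hql, zero_mul]

/-- **Fibre locality of "multiply by a function of `x_j` after a shear".**  For smooth `θ`, its band piece `θ_N`
(`|k_i| ≤ N`), a transversal shear `Φ = shearMap i j P` and a continuous `G` with summable coefficients:
`𝓕(G(x_j)·(θ_N∘Φ))(k) = 𝓕(G(x_j)·(θ∘Φ))(k)` for `|k_i| ≤ N`. [cite: Grafakos2014, Prop. 3.1.2 (5)] -/
theorem mFourierCoeff_evalMul_comp_shearMap_modePiece_eq {θ : UnitAddTorus d → ℂ} {i j : d} (hθ : IsSmooth θ)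
    (hij : i ≠ j) (P : ShearProfile) {G : UnitAddCircle → ℂ} (hG : Continuous G)
    (hGs : Summable fun q => ‖mFourierCoeff (fun x : UnitAddTorus d => G (x j)) q‖) (N : ℕ) {k : d → ℤ}
    (hk : |k i| ≤ (N : ℤ)) :
    mFourierCoeff (fun x => G (x j) * modePiece {k : d → ℤ | |k i| ≤ (N : ℤ)} θ (shearMap i j P x)) k =
      mFourierCoeff (fun x => G (x j) * θ (shearMap i j P x)) k := by
  set B : Set (d → ℤ) := {k : d → ℤ | |k i| ≤ (N : ℤ)} with hB
  have hN := isSmooth_modePiece hθ B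
  have hNc := isSmooth_modePiece hθ Bᶜ
  have hGc : Continuous fun x : UnitAddTorus d => G (x j) := hG.comp (continuous_apply j)
  -- `θ ∘ Φ = θ_N ∘ Φ + θ_{Bᶜ} ∘ Φ`
  have hsplit : (fun x => G (x j) * θ (shearMap i j P x)) =
      fun x => G (x j) * modePiece B θ (shearMap i j P x) + G (x j) * modePiece Bᶜ θ (shearMap i j P x) := by
    funext x
    rw [← mul_add]
    congr 1
    have h := congrFun (modePiece_add_modePiece_compl hθ B) (shearMap i j P x)
    rw [Pi.add_apply] at h
    exact h.symm
  have hint1 : Integrable (fun x => G (x j) * modePiece B θ (shearMap i j P x)) volume :=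
    (hGc.mul (hN.comp_shearMap i j P).continuous).integrable_unitAddTorus
  have hint2 : Integrable (fun x => G (x j) * modePiece Bᶜ θ (shearMap i j P x)) volume :=
    (hGc.mul (hNc.comp_shearMap i j P).continuous).integrable_unitAddTorus
  have hadd := mFourierCoeff_add hint1 hint2 k
  rw [hsplit, show (fun x => G (x j) * modePiece B θ (shearMap i j P x) + G (x j) * modePiece Bᶜ θ (shearMap i j P x)) =
      (fun x => G (x j) * modePiece B θ (shearMap i j P x)) + (fun x => G (x j) * modePiece Bᶜ θ (shearMap i j P x))
      from rfl, hadd]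
  -- the complementary piece has no modes with `|k_i| ≤ N`
  have hcomp_supp : ∀ k' : d → ℤ, k' i ∉ {n : ℤ | (N : ℤ) < |n|} →
      mFourierCoeff (modePiece Bᶜ θ ∘ shearMap i j P) k' = 0 := by
    intro k' hk'
    refine mFourierCoeff_comp_shearMap_eq_zero_of_apply_not_mem hNc.continuous
      hNc.rapidDecay_mFourierCoeff.summable_norm hij P (A := {n : ℤ | (N : ℤ) < |n|}) (fun k'' hk'' => ?_) hk'
    rw [mFourierCoeff_modePiece hθ, Set.indicator_of_notMem]
    simp only [Set.mem_compl_iff, Set.mem_setOf_eq, not_le, hB]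
    exact hk''
  have h0 : mFourierCoeff (fun x => G (x j) * modePiece Bᶜ θ (shearMap i j P x)) k = 0 :=
    mFourierCoeff_evalMul_eq_zero_of_apply_not_mem hG hij hGs (hNc.comp_shearMap i j P).continuous
      (A := {n : ℤ | (N : ℤ) < |n|}) hcomp_supp (by simpa using hk)
  rw [h0, add_zero]

/-! ## The two-strip estimate for every smooth function -/

/-- **Two-strip symbol energies for every smooth function** (squared form), from a per-fibre estimate on ALL fibres
`n ∈ ℤ` (cf. `tsum_symbol_sq_twoStrip_le_of_band_of_fibre`): the band limitation is removed by truncation, every finite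
partial sum of the left side being a partial sum for a band-limited truncation, with right side monotone in the band.
[cite: Grafakos2014, Prop. 3.1.2 (5) and Prop. 3.2.7 (3)] -/
theorem tsum_symbol_sq_twoStrip_le_of_fibre {θ : UnitAddTorus d → ℂ} {i j : d} (hθ : IsSmooth θ) (hij : i ≠ j)
    (P Xp Xm : ShearProfile) (bp bm : ℤ → ℤ) {m : (d → ℤ) → ℝ} {M : ℝ} (hmM : ∀ k, |m k| ≤ M) {Ap Am C : ℝ}
    (hAp0 : 0 ≤ Ap) (hAm0 : 0 ≤ Am) (hC0 : 0 ≤ C)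
    (hfib : ∀ n : ℤ, ∀ G : UnitAddTorus d → ℂ, IsSmooth G → (∀ k, mFourierCoeff G k ≠ 0 → k i = n) →
      ∑' k, m k ^ 2 * ‖mFourierCoeff (fun x => ((Xp.onCircle (x j) : ℂ) + Xm.onCircle (x j)) * G (shearMap i j P x)) k‖ ^ 2 ≤
        (Real.sqrt (∑' k, m (k - Pi.single j (bp n)) ^ 2 * ‖mFourierCoeff G k‖ ^ 2) + Ap * Real.sqrt (∫ x, ‖G x‖ ^ 2)) ^ 2 +
          (Real.sqrt (∑' k, m (k - Pi.single j (bm n)) ^ 2 * ‖mFourierCoeff G k‖ ^ 2) + Am * Real.sqrt (∫ x, ‖G x‖ ^ 2)) ^ 2 +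
          2 * C * ∫ x, ‖G x‖ ^ 2) :
    ∑' k, m k ^ 2 * ‖mFourierCoeff (fun x => ((Xp.onCircle (x j) : ℂ) + Xm.onCircle (x j)) * θ (shearMap i j P x)) k‖ ^ 2 ≤
      (Real.sqrt (∑' k, m (k - Pi.single j (bp (k i))) ^ 2 * ‖mFourierCoeff θ k‖ ^ 2) + Ap * Real.sqrt (∫ x, ‖θ x‖ ^ 2)) ^ 2 +
        (Real.sqrt (∑' k, m (k - Pi.single j (bm (k i))) ^ 2 * ‖mFourierCoeff θ k‖ ^ 2) + Am * Real.sqrt (∫ x, ‖θ x‖ ^ 2)) ^ 2 +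
        2 * C * ∫ x, ‖θ x‖ ^ 2 := by
  classical
  -- the multiplier `Ξ = (X⁺+X⁻)(x_j)` as a function of one coordinate
  set Gc : UnitAddCircle → ℂ := fun b => (Xp.onCircle b : ℂ) + Xm.onCircle b with hGc_def
  have hGc : Continuous Gc :=
    (Complex.continuous_ofReal.comp Xp.continuous_onCircle).add (Complex.continuous_ofReal.comp Xm.continuous_onCircle)
  have hΞ_smooth : IsSmooth (fun x : UnitAddTorus d => Gc (x j)) :=
    (isSmooth_onCircle_comp' Xp j).ofReal_comp.add (isSmooth_onCircle_comp' Xm j).ofReal_comp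
  have hGs : Summable fun q => ‖mFourierCoeff (fun x : UnitAddTorus d => Gc (x j)) q‖ :=
    hΞ_smooth.rapidDecay_mFourierCoeff.summable_norm
  have hHfun : (fun x => ((Xp.onCircle (x j) : ℂ) + Xm.onCircle (x j)) * θ (shearMap i j P x)) =
      fun x => Gc (x j) * θ (shearMap i j P x) := rfl
  have hH_c : Continuous fun x => Gc (x j) * θ (shearMap i j P x) :=
    hΞ_smooth.continuous.mul (hθ.comp_shearMap i j P).continuous
  -- the right-hand side
  set g := Real.sqrt (∫ x, ‖θ x‖ ^ 2) with hg
  set ap := Real.sqrt (∑' k, m (k - Pi.single j (bp (k i))) ^ 2 * ‖mFourierCoeff θ k‖ ^ 2) with hap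
  set am := Real.sqrt (∑' k, m (k - Pi.single j (bm (k i))) ^ 2 * ‖mFourierCoeff θ k‖ ^ 2) with ham
  set R : ℝ := (ap + Ap * g) ^ 2 + (am + Am * g) ^ 2 + 2 * C * ∫ x, ‖θ x‖ ^ 2 with hR
  have hmpM : ∀ k : d → ℤ, |m (k - Pi.single j (bp (k i)))| ≤ M := fun k => hmM _
  have hmmM : ∀ k : d → ℤ, |m (k - Pi.single j (bm (k i)))| ≤ M := fun k => hmM _
  have hParsθ := hasSum_sq_mFourierCoeff_of_continuous hθ.continuous
  have hwp := summable_symbol_sq hθ.continuous hmpM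
  have hwm := summable_symbol_sq hθ.continuous hmmM
  have hwH := summable_symbol_sq hH_c hmM
  -- every finite partial sum of the left side is bounded by `R`
  have hfin : ∀ T : Finset (d → ℤ), ∑ k ∈ T, m k ^ 2 * ‖mFourierCoeff (fun x => Gc (x j) * θ (shearMap i j P x)) k‖ ^ 2 ≤ R := by
    intro T
    obtain ⟨N, hN⟩ : ∃ N : ℕ, ∀ k ∈ T, |k i| ≤ (N : ℤ) := by
      refine ⟨T.sup fun k => (k i).natAbs, fun k hk => ?_⟩
      have h1 : (k i).natAbs ≤ T.sup fun k => (k i).natAbs := Finset.le_sup (f := fun k => (k i).natAbs) hk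
      calc |k i| = ((k i).natAbs : ℤ) := (Int.natCast_natAbs (k i)).symm
        _ ≤ _ := by exact_mod_cast h1
    set B : Set (d → ℤ) := {k : d → ℤ | |k i| ≤ (N : ℤ)} with hB
    set θN : UnitAddTorus d → ℂ := modePiece B θ with hθN
    have hθN_smooth : IsSmooth θN := isSmooth_modePiece hθ B
    have hθN_coeff : ∀ k, mFourierCoeff θN k = B.indicator (mFourierCoeff θ) k := mFourierCoeff_modePiece hθ B
    have hband : ∀ k, mFourierCoeff θN k ≠ 0 → k i ∈ Finset.Icc (-(N : ℤ)) N := by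
      intro k hk
      rw [hθN_coeff] at hk
      have hkB : k ∈ B := by
        by_contra h; exact hk (Set.indicator_of_notMem h _)
      rw [Finset.mem_Icc]
      exact abs_le.mp hkB
    -- the band-limited lemma for `θN`
    have hBL := tsum_symbol_sq_twoStrip_le_of_band_of_fibre hθN_smooth hij (Finset.Icc (-(N : ℤ)) N) hband P Xp Xm bp bm
      hmM hAp0 hAm0 (fun n _ => hfib n)
    -- monotonicity of the right side in the truncation
    have hcoeff_le : ∀ k, ‖mFourierCoeff θN k‖ ^ 2 ≤ ‖mFourierCoeff θ k‖ ^ 2 := fun k => by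
      rw [hθN_coeff, norm_indicator_eq_indicator_norm]
      exact pow_le_pow_left₀ (Set.indicator_nonneg (fun _ _ => norm_nonneg _) k)
        (Set.indicator_le_self' (fun _ _ => norm_nonneg _) k) 2
    have hParsN := hasSum_sq_mFourierCoeff_of_continuous hθN_smooth.continuous
    have h1p : ∑' k, m (k - Pi.single j (bp (k i))) ^ 2 * ‖mFourierCoeff θN k‖ ^ 2 ≤
        ∑' k, m (k - Pi.single j (bp (k i))) ^ 2 * ‖mFourierCoeff θ k‖ ^ 2 :=
      (summable_symbol_sq hθN_smooth.continuous hmpM).tsum_le_tsum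
        (fun k => mul_le_mul_of_nonneg_left (hcoeff_le k) (sq_nonneg _)) hwp
    have h1m : ∑' k, m (k - Pi.single j (bm (k i))) ^ 2 * ‖mFourierCoeff θN k‖ ^ 2 ≤
        ∑' k, m (k - Pi.single j (bm (k i))) ^ 2 * ‖mFourierCoeff θ k‖ ^ 2 :=
      (summable_symbol_sq hθN_smooth.continuous hmmM).tsum_le_tsum
        (fun k => mul_le_mul_of_nonneg_left (hcoeff_le k) (sq_nonneg _)) hwm
    have h2 : ∫ x, ‖θN x‖ ^ 2 ≤ ∫ x, ‖θ x‖ ^ 2 := by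
      rw [← hParsN.tsum_eq, ← hParsθ.tsum_eq]
      exact hParsN.summable.tsum_le_tsum hcoeff_le hParsθ.summable
    have hgN : Real.sqrt (∫ x, ‖θN x‖ ^ 2) ≤ g := Real.sqrt_le_sqrt h2
    have hapN : Real.sqrt (∑' k, m (k - Pi.single j (bp (k i))) ^ 2 * ‖mFourierCoeff θN k‖ ^ 2) ≤ ap :=
      Real.sqrt_le_sqrt h1p
    have hamN : Real.sqrt (∑' k, m (k - Pi.single j (bm (k i))) ^ 2 * ‖mFourierCoeff θN k‖ ^ 2) ≤ am :=
      Real.sqrt_le_sqrt h1m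
    have hRN : (Real.sqrt (∑' k, m (k - Pi.single j (bp (k i))) ^ 2 * ‖mFourierCoeff θN k‖ ^ 2) +
          Ap * Real.sqrt (∫ x, ‖θN x‖ ^ 2)) ^ 2 +
        (Real.sqrt (∑' k, m (k - Pi.single j (bm (k i))) ^ 2 * ‖mFourierCoeff θN k‖ ^ 2) +
          Am * Real.sqrt (∫ x, ‖θN x‖ ^ 2)) ^ 2 + 2 * C * ∫ x, ‖θN x‖ ^ 2 ≤ R := by
      have hq1 : (Real.sqrt (∑' k, m (k - Pi.single j (bp (k i))) ^ 2 * ‖mFourierCoeff θN k‖ ^ 2) +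
          Ap * Real.sqrt (∫ x, ‖θN x‖ ^ 2)) ^ 2 ≤ (ap + Ap * g) ^ 2 :=
        pow_le_pow_left₀ (add_nonneg (Real.sqrt_nonneg _) (mul_nonneg hAp0 (Real.sqrt_nonneg _)))
          (add_le_add hapN (mul_le_mul_of_nonneg_left hgN hAp0)) 2
      have hq2 : (Real.sqrt (∑' k, m (k - Pi.single j (bm (k i))) ^ 2 * ‖mFourierCoeff θN k‖ ^ 2) +
          Am * Real.sqrt (∫ x, ‖θN x‖ ^ 2)) ^ 2 ≤ (am + Am * g) ^ 2 :=
        pow_le_pow_left₀ (add_nonneg (Real.sqrt_nonneg _) (mul_nonneg hAm0 (Real.sqrt_nonneg _)))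
          (add_le_add hamN (mul_le_mul_of_nonneg_left hgN hAm0)) 2
      have hq3 : 2 * C * ∫ x, ‖θN x‖ ^ 2 ≤ 2 * C * ∫ x, ‖θ x‖ ^ 2 :=
        mul_le_mul_of_nonneg_left h2 (by positivity)
      rw [hR]; linarith
    -- the partial sum over `T` is a partial sum for `θN`
    have hHN_c : Continuous fun x => Gc (x j) * θN (shearMap i j P x) :=
      hΞ_smooth.continuous.mul (hθN_smooth.comp_shearMap i j P).continuous
    have hwN := summable_symbol_sq hHN_c hmM
    have hT : ∑ k ∈ T, m k ^ 2 * ‖mFourierCoeff (fun x => Gc (x j) * θ (shearMap i j P x)) k‖ ^ 2 =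
        ∑ k ∈ T, m k ^ 2 * ‖mFourierCoeff (fun x => Gc (x j) * θN (shearMap i j P x)) k‖ ^ 2 :=
      Finset.sum_congr rfl fun k hk => by
        rw [hθN, mFourierCoeff_evalMul_comp_shearMap_modePiece_eq hθ hij P hGc hGs N (hN k hk)]
    have hBL' : ∑' k, m k ^ 2 * ‖mFourierCoeff (fun x => Gc (x j) * θN (shearMap i j P x)) k‖ ^ 2 ≤ R :=
      hBL.trans hRN
    calc ∑ k ∈ T, m k ^ 2 * ‖mFourierCoeff (fun x => Gc (x j) * θ (shearMap i j P x)) k‖ ^ 2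
        = ∑ k ∈ T, m k ^ 2 * ‖mFourierCoeff (fun x => Gc (x j) * θN (shearMap i j P x)) k‖ ^ 2 := hT
      _ ≤ ∑' k, m k ^ 2 * ‖mFourierCoeff (fun x => Gc (x j) * θN (shearMap i j P x)) k‖ ^ 2 :=
          hwN.sum_le_tsum T fun k _ => by positivity
      _ ≤ R := hBL'
  rw [hHfun]
  exact hwH.tsum_le_of_sum_le hfin

/-- **The half-slot un-gauging step in `√`-form, every smooth function, abstract per-fibre estimate**: under the
compatibility `m(k − b⁺_{k_i}e_j)² + m(k − b⁻_{k_i}e_j)² ≤ μ(k)²` of the new symbol `m` with the old symbol `μ`,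
`‖m(D)((X⁺+X⁻)(x_j)·(θ∘Φ))‖ ≤ ‖μ(D)θ‖ + (√(A⁺²+A⁻²) + √(2C)) ‖θ‖`. [cite: Grafakos2014, Prop. 3.1.2 (5) and Prop. 3.2.7 (3)] -/
theorem sqrt_tsum_symbol_sq_twoStrip_le_of_fibre {θ : UnitAddTorus d → ℂ} {i j : d} (hθ : IsSmooth θ) (hij : i ≠ j)
    (P Xp Xm : ShearProfile) (bp bm : ℤ → ℤ) {m : (d → ℤ) → ℝ} {M : ℝ} (hmM : ∀ k, |m k| ≤ M) {Ap Am C : ℝ}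
    (hAp0 : 0 ≤ Ap) (hAm0 : 0 ≤ Am) (hC0 : 0 ≤ C)
    (hfib : ∀ n : ℤ, ∀ G : UnitAddTorus d → ℂ, IsSmooth G → (∀ k, mFourierCoeff G k ≠ 0 → k i = n) →
      ∑' k, m k ^ 2 * ‖mFourierCoeff (fun x => ((Xp.onCircle (x j) : ℂ) + Xm.onCircle (x j)) * G (shearMap i j P x)) k‖ ^ 2 ≤
        (Real.sqrt (∑' k, m (k - Pi.single j (bp n)) ^ 2 * ‖mFourierCoeff G k‖ ^ 2) + Ap * Real.sqrt (∫ x, ‖G x‖ ^ 2)) ^ 2 +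
          (Real.sqrt (∑' k, m (k - Pi.single j (bm n)) ^ 2 * ‖mFourierCoeff G k‖ ^ 2) + Am * Real.sqrt (∫ x, ‖G x‖ ^ 2)) ^ 2 +
          2 * C * ∫ x, ‖G x‖ ^ 2)
    {μ : (d → ℤ) → ℝ} {M' : ℝ} (hμM : ∀ k, |μ k| ≤ M')
    (hcomp : ∀ k : d → ℤ, m (k - Pi.single j (bp (k i))) ^ 2 + m (k - Pi.single j (bm (k i))) ^ 2 ≤ μ k ^ 2) :
    Real.sqrt (∑' k, m k ^ 2 *
        ‖mFourierCoeff (fun x => ((Xp.onCircle (x j) : ℂ) + Xm.onCircle (x j)) * θ (shearMap i j P x)) k‖ ^ 2) ≤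
      Real.sqrt (∑' k, μ k ^ 2 * ‖mFourierCoeff θ k‖ ^ 2) +
        (Real.sqrt (Ap ^ 2 + Am ^ 2) + Real.sqrt (2 * C)) * Real.sqrt (∫ x, ‖θ x‖ ^ 2) := by
  have hmain := tsum_symbol_sq_twoStrip_le_of_fibre hθ hij P Xp Xm bp bm hmM hAp0 hAm0 hC0 hfib
  have hmpM : ∀ k : d → ℤ, |m (k - Pi.single j (bp (k i)))| ≤ M := fun k => hmM _
  have hmmM : ∀ k : d → ℤ, |m (k - Pi.single j (bm (k i)))| ≤ M := fun k => hmM _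
  have hsp := summable_symbol_sq hθ.continuous hmpM
  have hsm := summable_symbol_sq hθ.continuous hmmM
  have hsμ := summable_symbol_sq hθ.continuous hμM
  have hsum2 : ∑' k, m (k - Pi.single j (bp (k i))) ^ 2 * ‖mFourierCoeff θ k‖ ^ 2 +
      ∑' k, m (k - Pi.single j (bm (k i))) ^ 2 * ‖mFourierCoeff θ k‖ ^ 2 ≤ ∑' k, μ k ^ 2 * ‖mFourierCoeff θ k‖ ^ 2 := by
    rw [← hsp.tsum_add hsm]
    exact (hsp.add hsm).tsum_le_tsum (fun k => by
      rw [← add_mul]; exact mul_le_mul_of_nonneg_right (hcomp k) (sq_nonneg _)) hsμ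
  exact sqrt_le_of_twoStrip_sq_le (tsum_nonneg fun k => by positivity) (tsum_nonneg fun k => by positivity)
    (integral_nonneg fun x => by positivity) hAp0 hAm0 hC0 hmain hsum2

/-- **Un-gauging the two flat-strip families for every smooth function**, the per-fibre estimate discharged by
`tsum_symbol_sq_twoStrip_fibre_le` (un-gauging + the two-branch step) with uniform `ω`/`ω₂`-moment bounds `A⁺, A⁻, C`
over all fibres. [cite: Grafakos2014, Prop. 3.1.2 (5) and Prop. 3.2.7 (3)] -/
theorem tsum_symbol_sq_twoStrip_le {θ : UnitAddTorus d → ℂ} {i j : d} (hθ : IsSmooth θ) (hij : i ≠ j)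
    (P Xp Xm : ShearProfile) (hXp1 : ∀ y, |Xp y| ≤ 1) (hXm1 : ∀ y, |Xm y| ≤ 1) (hdis : ∀ y, Xp y * Xm y = 0)
    (bp bm : ℤ → ℤ) {m : (d → ℤ) → ℝ} {M : ℝ} (hmM : ∀ k, |m k| ≤ M)
    {mf : ℤ → (d → ℤ) → ℝ} (hmf : ∀ n k, k i = n → mf n k = m k) (hmfM : ∀ n k, |mf n k| ≤ M)
    {ω ω₂ : ℤ → (d → ℤ) → ℝ} (hω0 : ∀ n q, 0 ≤ ω n q) (hω : ∀ n k q, |mf n k - mf n (k - q)| ≤ ω n q)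
    (hω₂0 : ∀ n q, 0 ≤ ω₂ n q) (hω₂ : ∀ n k q, |mf n k ^ 2 - mf n (k - q) ^ 2| ≤ ω₂ n q)
    (hωp : ∀ n, Summable fun q => ω n q *
      ‖mFourierCoeff (fun x : UnitAddTorus d => (Xp.onCircle (x j) : ℂ) * twist P n (x j) * mFourier (Pi.single j (bp n)) x) q‖)
    (hωm : ∀ n, Summable fun q => ω n q *
      ‖mFourierCoeff (fun x : UnitAddTorus d => (Xm.onCircle (x j) : ℂ) * twist P n (x j) * mFourier (Pi.single j (bm n)) x) q‖)
    (hω₂p : ∀ n, Summable fun q => ω₂ n q *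
      ‖mFourierCoeff (fun x : UnitAddTorus d => (Xp.onCircle (x j) : ℂ) * twist P n (x j) * mFourier (Pi.single j (bp n)) x) q‖)
    {Ap Am C : ℝ} (hAp0 : 0 ≤ Ap) (hAm0 : 0 ≤ Am) (hC0 : 0 ≤ C)
    (hAp : ∀ n, ∑' q, ω n q *
      ‖mFourierCoeff (fun x : UnitAddTorus d => (Xp.onCircle (x j) : ℂ) * twist P n (x j) * mFourier (Pi.single j (bp n)) x) q‖ ≤ Ap)
    (hAm : ∀ n, ∑' q, ω n q *
      ‖mFourierCoeff (fun x : UnitAddTorus d => (Xm.onCircle (x j) : ℂ) * twist P n (x j) * mFourier (Pi.single j (bm n)) x) q‖ ≤ Am)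
    (hC : ∀ n, ∑' q, ω₂ n q *
      ‖mFourierCoeff (fun x : UnitAddTorus d => (Xp.onCircle (x j) : ℂ) * twist P n (x j) * mFourier (Pi.single j (bp n)) x) q‖ ≤ C) :
    ∑' k, m k ^ 2 * ‖mFourierCoeff (fun x => ((Xp.onCircle (x j) : ℂ) + Xm.onCircle (x j)) * θ (shearMap i j P x)) k‖ ^ 2 ≤
      (Real.sqrt (∑' k, m (k - Pi.single j (bp (k i))) ^ 2 * ‖mFourierCoeff θ k‖ ^ 2) + Ap * Real.sqrt (∫ x, ‖θ x‖ ^ 2)) ^ 2 +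
        (Real.sqrt (∑' k, m (k - Pi.single j (bm (k i))) ^ 2 * ‖mFourierCoeff θ k‖ ^ 2) + Am * Real.sqrt (∫ x, ‖θ x‖ ^ 2)) ^ 2 +
        2 * C * ∫ x, ‖θ x‖ ^ 2 := by
  refine tsum_symbol_sq_twoStrip_le_of_fibre hθ hij P Xp Xm bp bm hmM hAp0 hAm0 hC0 fun n G hG hGn => ?_
  have h := tsum_symbol_sq_twoStrip_fibre_le hG hij hGn P Xp Xm hXp1 hXm1 hdis (bp n) (bm n) (hmf n) (hmfM n) (hω0 n)
    (hω n) (hω₂0 n) (hω₂ n) (hωp n) (hωm n) (hω₂p n)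
  have hg0 : 0 ≤ Real.sqrt (∫ x, ‖G x‖ ^ 2) := Real.sqrt_nonneg _
  have hSp0 : 0 ≤ ∑' q, ω n q * ‖mFourierCoeff (fun x : UnitAddTorus d =>
      (Xp.onCircle (x j) : ℂ) * twist P n (x j) * mFourier (Pi.single j (bp n)) x) q‖ :=
    tsum_nonneg fun q => mul_nonneg (hω0 n q) (norm_nonneg _)
  have hSm0 : 0 ≤ ∑' q, ω n q * ‖mFourierCoeff (fun x : UnitAddTorus d =>
      (Xm.onCircle (x j) : ℂ) * twist P n (x j) * mFourier (Pi.single j (bm n)) x) q‖ :=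
    tsum_nonneg fun q => mul_nonneg (hω0 n q) (norm_nonneg _)
  have h1p : (Real.sqrt (∑' k, m (k - Pi.single j (bp n)) ^ 2 * ‖mFourierCoeff G k‖ ^ 2) +
      (∑' q, ω n q * ‖mFourierCoeff (fun x : UnitAddTorus d =>
        (Xp.onCircle (x j) : ℂ) * twist P n (x j) * mFourier (Pi.single j (bp n)) x) q‖) * Real.sqrt (∫ x, ‖G x‖ ^ 2)) ^ 2 ≤
      (Real.sqrt (∑' k, m (k - Pi.single j (bp n)) ^ 2 * ‖mFourierCoeff G k‖ ^ 2) + Ap * Real.sqrt (∫ x, ‖G x‖ ^ 2)) ^ 2 :=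
    pow_le_pow_left₀ (add_nonneg (Real.sqrt_nonneg _) (mul_nonneg hSp0 hg0))
      (add_le_add le_rfl (mul_le_mul_of_nonneg_right (hAp n) hg0)) 2
  have h1m : (Real.sqrt (∑' k, m (k - Pi.single j (bm n)) ^ 2 * ‖mFourierCoeff G k‖ ^ 2) +
      (∑' q, ω n q * ‖mFourierCoeff (fun x : UnitAddTorus d =>
        (Xm.onCircle (x j) : ℂ) * twist P n (x j) * mFourier (Pi.single j (bm n)) x) q‖) * Real.sqrt (∫ x, ‖G x‖ ^ 2)) ^ 2 ≤
      (Real.sqrt (∑' k, m (k - Pi.single j (bm n)) ^ 2 * ‖mFourierCoeff G k‖ ^ 2) + Am * Real.sqrt (∫ x, ‖G x‖ ^ 2)) ^ 2 :=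
    pow_le_pow_left₀ (add_nonneg (Real.sqrt_nonneg _) (mul_nonneg hSm0 hg0))
      (add_le_add le_rfl (mul_le_mul_of_nonneg_right (hAm n) hg0)) 2
  have h1c : 2 * ((∑' q, ω₂ n q * ‖mFourierCoeff (fun x : UnitAddTorus d =>
      (Xp.onCircle (x j) : ℂ) * twist P n (x j) * mFourier (Pi.single j (bp n)) x) q‖) * ∫ x, ‖G x‖ ^ 2) ≤
      2 * C * ∫ x, ‖G x‖ ^ 2 := by
    rw [mul_assoc]
    exact mul_le_mul_of_nonneg_left (mul_le_mul_of_nonneg_right (hC n) (integral_nonneg fun x => by positivity))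
      zero_le_two
  linarith

end Summit.AnomalousDissipation.AnomalousDissipation.Theorems.SawtoothPulseCascade.K1Slot
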